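import Literature.AnabelianGeometry.EtaleTheta.Setting
import Literature.Topology.Algebra.ProfiniteTopologicalGenerators
import HarnessLib

/-!
# [EtTh] §1 p. 12: the two free generators of `Δ_X` topologically generate `Δ_X`
# (proof-only companion of the guard `IsFreeProfiniteOnTwo` / `IsEtThOrigin`)

Mochizuki, *The étale theta function and its Frobenioid-theoretic manifestations*, Publ. RIMS **45**
(2009) [EtTh], §1 PRIMS PDF p. 12: "Since `Δ_X` is a profinite free group on 2 generators"
[cite: MochizukiEtTh2009, §1 p.12].  Layer L2 of the abc-iut cell, seat abc-iut-L5-t14 (item N8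
context).  PROOF-ONLY, no definition.

The root file `Setting.lean` (abc-iut-L2-t1) records freeness of `Δ_X` as the universal property
`IsFreeProfiniteOnTwo` with UNIQUENESS against finite discrete groups.  From the generic
`Literature.Topology.Algebra.topologicalClosure_closure_eq_top_of_hom_ext` (uniqueness ⇒ topological
generation) we get the form most arguments about the theta group `Δ^Θ_X = Δ_X/[Δ_X,[Δ_X,Δ_X]]` start
from: generators `a, b` with the universal property AND `⟨a, b⟩⁻ = Δ_X`
(`IsFreeProfiniteOnTwo.exists_generators`, `ThetaSetting.IsEtThOrigin.exists_topologicalGenerators`).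
HONEST FRAMING: nothing is asserted about the existence of the setting; classical group theory.
-/

namespace Literature.AnabelianGeometry.EtaleTheta

open _root_.Topology

/-- **Free generators topologically generate** ([EtTh] p. 12 "`Δ_X` is a profinite free group on 2
generators"): if `P` is profinite free on two generators in the sense of `IsFreeProfiniteOnTwo`
(universal property with uniqueness against finite discrete groups), then there are `a, b ∈ P` with
that universal property which moreover generate a DENSE subgroup of `P`.
[cite: MochizukiEtTh2009, §1 p.12] -/
theorem IsFreeProfiniteOnTwo.exists_generators {P : Type} [Group P] [TopologicalSpace P]
    [IsTopologicalGroup P] (h : IsFreeProfiniteOnTwo P) :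
    ∃ a b : P, (∀ (Q : Type) [Group Q] [Finite Q] [TopologicalSpace Q] [DiscreteTopology Q]
      (x y : Q), ∃! f : P →ₜ* Q, f a = x ∧ f b = y) ∧
      (Subgroup.closure {a, b}).topologicalClosure = ⊤ := by
  obtain ⟨hc, _, hTD, a, b, huniv⟩ := h
  refine ⟨a, b, huniv, ?_⟩
  refine Literature.Topology.Algebra.topologicalClosure_closure_eq_top_of_hom_ext {a, b}
    fun W _ _ _ _ f₁ f₂ hS => ?_
  obtain ⟨f, -, huniq⟩ := huniv W (f₁ a) (f₁ b)
  exact (huniq f₁ ⟨rfl, rfl⟩).trans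
    (huniq f₂ ⟨(hS a (by simp)).symm, (hS b (by simp)).symm⟩).symm

namespace ThetaSetting

variable {p : ℕ} [Fact p.Prime] {D : ThetaSetting p}

/-- For a theta setting of [EtTh] origin, `Δ_X` has two elements `a, b` with the free universal
property which topologically generate `Δ_X` (p. 12). [cite: MochizukiEtTh2009, §1 p.12] -/
theorem IsEtThOrigin.exists_topologicalGenerators (hO : D.IsEtThOrigin) :
    ∃ a b : D.DeltaHat, (∀ (Q : Type) [Group Q] [Finite Q] [TopologicalSpace Q] [DiscreteTopology Q]
      (x y : Q), ∃! f : D.DeltaHat →ₜ* Q, f a = x ∧ f b = y) ∧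
      (Subgroup.closure {a, b}).topologicalClosure = ⊤ :=
  hO.deltaHat_free.exists_generators

end ThetaSetting

end Literature.AnabelianGeometry.EtaleTheta
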